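import Literature.AlgebraicGeometry.Resolution.JoinRationalMapPoints
import Literature.AlgebraicGeometry.Motives.TensorCentreHosts
import Literature.AlgebraicGeometry.Motives.GeneratingSectionsOfHomAppLE
import Literature.AlgebraicGeometry.Resolution.BlowupsIntegral
import HarnessLib

/-!
# Shioda–Katsura's morphism `ψ = (v x : u y)` on the blow-up of `X₁ ⊗ X₂` along `pr₁⁻¹K₁ + pr₂⁻¹K₂`

Topic `Literature/AlgebraicGeometry/Motives`; theorem-only. Let `X₁ → ℙ^{a+1}_k`,
`X₂ → ℙ^{b+1}_k` be `k`-schemes over projective spaces with distinguished last coordinates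
`u = x_{a+1}`, `v = y_{b+1}`, and let `K₁`, `K₂` be ideal sheaves on `X₁`, `X₂` cut out, on affine
charts around every point, by the nonzerodivisors `u/xᵢ` resp. `v/y_j` (`i ≤ a`, `j ≤ b`) — e.g.
the ideals of the hyperplane sections `Xⁿₘ = Xⁿ⁺¹ₘ ∩ {x_{n+2} = 0}` of the Fermat varieties
(`HodgeTheory/FermatSectionChartIdeal`). For a blowing up `β : Z → X₁ ⊗ X₂` along the product
centre `𝓘 = pr₁⁻¹K₁ + pr₂⁻¹K₂` (`Motives/TensorClosedSubschemeCentre`; Shioda–Katsura, Tôhoku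
Math. J. 31 (1979), (1.6)) with `Z` integral we prove:

* `exists_ofSection_eq_div_of_mem_blowupChart`, `isRegularAt_div_of_mem_blowupChart` — on the
  principal chart `Z[W, g]` of any blowing up the rational function `[π^*s]/[π^*g]`, `s ∈ I(W)`,
  is (the rational function of a section, hence) regular;
* `exists_chart_section_blowup`, `locallyComparable_blowup` — on `Z`, `u/xᵢ` and `v/y_j` are
  locally comparable (the hypothesis `hZ` of `Resolution/JoinRationalMap`): `Z` is covered by
  the charts `Z[W, u']`, `Z[W, v']` of the regular-pair centre (`exists_chart_tensorCentre`,
  `IsBlowup.blowupChart_sup_blowupChart_pair`), on which the exceptional coordinate `u'/v'`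
  resp. `v'/u'` is a section;
* hence Shioda–Katsura's rational map `((x:u),(y:v)) ↦ (v x : u y)` IS A MORPHISM
  `ψ = RuledJoin.joinMap … : Z → ℙᴺ_k`, `N + 1 = (a+1)+(b+1)` (Thm. 1.7 (i) of loc. cit., there
  followed by the diagonal twist `ε`), and `exists_comp_joinMap_eq_pointOfVec` — **on `L`-valued
  points `ψ(κ) = (s x : t y)`**, `(s, t) ≠ (0, 0)`, for `κ` with images `(x)`, `(y)` in the two
  projective spaces (`Resolution/JoinRationalMapPoints`). Restricted to the exceptional host over
  a sub-centre `Y₁ ⊗ Y₂` (`Motives/TensorCentreHosts`), where `u = v = 0`, this is the ruled join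
  of `Y₁ ⊂ {u = 0}` and `Y₂ ⊂ {v = 0}` (Shioda, Math. Ann. 245 (1979), proof of Thm. I) — the
  assembly of that span is the sequel `Motives/RuledJoinHost`.

## References

* T. Shioda, T. Katsura, On Fermat varieties, Tôhoku Math. J. 31 (1979) 97–115, §1 (1.6)–(1.8),
  Thm. 1.7. [ShiodaKatsura1979]
* T. Shioda, The Hodge conjecture for Fermat varieties, Math. Ann. 245 (1979) 175–184, proof of
  Thm. I. [Shioda1979HodgeFermat]
* The Stacks Project, Tag 0804 (charts of a blowing up). [StacksProject]
* R. Hartshorne, *Algebraic Geometry* (1977), II Thm. 7.1. [Hartshorne1977]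
-/

noncomputable section

open CategoryTheory CategoryTheory.Limits AlgebraicGeometry MonoidalCategory TopologicalSpace
  Opposite

namespace Literature.AlgebraicGeometry.Motives

open Literature.AlgebraicGeometry.Resolution Literature.AlgebraicGeometry.Motives.RatFn
  Literature.AlgebraicGeometry.Motives.Segre

attribute [local instance] MvPolynomial.gradedAlgebra

/-! ## Ratios of pulled-back generators on a principal chart of a blowing up -/

section Blowup

variable {Z M : Scheme} [IsIntegral Z] (π : Z ⟶ M) (I : M.IdealSheafData) (W : M.affineOpens)

/-- On a non-empty principal chart piece the pulled-back generator `π^*g` has non-zero rational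
function (it is a nonzerodivisor of a non-zero ring). [folklore] -/
theorem ofSection_appLE_ne_zero_of_isPrincipalChart {g : Γ(M, W)} {W' : Z.affineOpens}
    (hW' : IsPrincipalChart π I W g W') {z : Z} (hz : z ∈ (W' : Z.Opens)) :
    ofSection (genericPoint_mem_of_mem hz) (π.appLE W W' hW'.le_preimage g) ≠ 0 := by
  obtain ⟨h, hnzd, -⟩ := hW'
  haveI : Nontrivial Γ(Z, W') := ⟨⟨1, 0, fun h10 ↦ one_ne_zero (α := Z.presheaf.stalk z) (by
    rw [← map_one (Z.presheaf.germ _ z hz).hom, h10, map_zero])⟩⟩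
  intro h0
  have : π.appLE W W' h g = 0 := ofSection_injective (genericPoint_mem_of_mem hz)
    (h0.trans (ofSection_zero _).symm)
  rw [this] at hnzd
  exact zero_notMem_nonZeroDivisors hnzd

/-- **On the principal chart `Z[W, g]` the rational function `[π^*s]/[π^*g]`, `s ∈ I(W)`, is the
rational function of a section** `c` over a principal affine piece `W' ∋ z`: there
`π^*s = c · π^*g` (`IsPrincipalChart.exists_eq_mul`). [cite: StacksProject, Tag 0804] -/
theorem exists_ofSection_eq_div_of_mem_blowupChart {g s : Γ(M, W)} (hs : s ∈ I.ideal W) {z : Z}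
    (hz : z ∈ blowupChart π I W g) :
    ∃ (W' : Z.affineOpens) (hzW' : z ∈ (W' : Z.Opens)),
      (W' : Z.Opens) ≤ π ⁻¹ᵁ (W : M.Opens) ∧ ∃ c : Γ(Z, W'),
      ofSection (genericPoint_mem_of_mem hzW') c =
        ofSection (U := π ⁻¹ᵁ (W : M.Opens))
          (genericPoint_mem_of_mem (blowupChart_le_preimage π I W g hz)) (π.appLE W _ le_rfl s) /
        ofSection (U := π ⁻¹ᵁ (W : M.Opens))
          (genericPoint_mem_of_mem (blowupChart_le_preimage π I W g hz)) (π.appLE W _ le_rfl g) := by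
  obtain ⟨W', hW', hzW'⟩ := mem_blowupChart_iff.mp hz
  obtain ⟨c, hc⟩ := hW'.exists_eq_mul hs
  have hη' : genericPoint Z ∈ (W' : Z.Opens) := genericPoint_mem_of_mem hzW'
  have hg0 := ofSection_appLE_ne_zero_of_isPrincipalChart π I W hW' hzW'
  have hres : ∀ t : Γ(M, W), ofSection (U := π ⁻¹ᵁ (W : M.Opens))
      (genericPoint_mem_of_mem (blowupChart_le_preimage π I W g hz)) (π.appLE W _ le_rfl t) =
      ofSection hη' (π.appLE W W' hW'.le_preimage t) := fun t ↦ by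
    rw [← map_appLE_eq (le_rfl : π ⁻¹ᵁ (W : M.Opens) ≤ _) hW'.le_preimage t, ofSection_map]
  refine ⟨W', hzW', hW'.le_preimage, c, ?_⟩
  rw [hres, hres, hc, ofSection_mul, mul_div_assoc, div_self hg0, mul_one]

/-- Hence on `Z[W, g]` the rational function `[π^*s]/[π^*g]`, `s ∈ I(W)`, is regular.
[cite: StacksProject, Tag 0804] -/
theorem isRegularAt_div_of_mem_blowupChart {g s : Γ(M, W)} (hs : s ∈ I.ideal W) {z : Z}
    (hz : z ∈ blowupChart π I W g) :
    IsRegularAt z (ofSection (U := π ⁻¹ᵁ (W : M.Opens))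
        (genericPoint_mem_of_mem (blowupChart_le_preimage π I W g hz)) (π.appLE W _ le_rfl s) /
      ofSection (U := π ⁻¹ᵁ (W : M.Opens))
        (genericPoint_mem_of_mem (blowupChart_le_preimage π I W g hz)) (π.appLE W _ le_rfl g)) := by
  obtain ⟨W', hzW', -, c, hc⟩ := exists_ofSection_eq_div_of_mem_blowupChart π I W hs hz
  rw [← hc, ofSection_eq_toFunctionField hzW']
  exact isRegularAt_germ hzW' c

end Blowup

/-! ## The blow-up of `X₁ ⊗ X₂` along `pr₁⁻¹K₁ + pr₂⁻¹K₂`: `ψ` is a morphism -/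

section Psi

variable {k : Type} [Field k] {a b : ℕ} (X₁ X₂ : SchemeOver k)
  (f₁ : X₁.left ⟶ Proj (grading (Fin (a + 2)) k)) (f₂ : X₂.left ⟶ Proj (grading (Fin (b + 2)) k))
  (K₁ : X₁.left.IdealSheafData) (K₂ : X₂.left.IdealSheafData)

set_option quotPrecheck false in
/-- Local notation: the centre `𝓘 = pr₁⁻¹K₁·𝒪 + pr₂⁻¹K₂·𝒪`. -/
local notation "𝓘" => (Scheme.IdealSheafData.comap K₁ (pullback.fst X₁.hom X₂.hom) ⊔
  Scheme.IdealSheafData.comap K₂ (pullback.snd X₁.hom X₂.hom))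

/-! The chart hypotheses: `K₁` (`K₂`) is cut out around every point, on an affine chart inside
some `f₁⁻¹D₊(xᵢ)`, `i ≤ a` (`f₂⁻¹D₊(y_j)`, `j ≤ b`), by the nonzerodivisor `u/xᵢ` (`v/y_j`). -/

variable
  (hc₁ : ∀ x : X₁.left, ∃ (U : X₁.left.affineOpens) (i : Fin (a + 1))
    (hU : (U : X₁.left.Opens) ≤ GeneratingSections.preU f₁ i.castSucc),
    x ∈ (U : X₁.left.Opens) ∧
    K₁.ideal U = Ideal.span {X₁.left.presheaf.map (homOfLE hU).op (GeneratingSections.homRatio f₁ i.castSucc (Fin.last (a + 1)))} ∧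
    X₁.left.presheaf.map (homOfLE hU).op (GeneratingSections.homRatio f₁ i.castSucc (Fin.last (a + 1))) ∈ nonZeroDivisors Γ(X₁.left, U))
  (hc₂ : ∀ y : X₂.left, ∃ (V : X₂.left.affineOpens) (j : Fin (b + 1))
    (hV : (V : X₂.left.Opens) ≤ GeneratingSections.preU f₂ j.castSucc),
    y ∈ (V : X₂.left.Opens) ∧
    K₂.ideal V = Ideal.span {X₂.left.presheaf.map (homOfLE hV).op (GeneratingSections.homRatio f₂ j.castSucc (Fin.last (b + 1)))} ∧
    X₂.left.presheaf.map (homOfLE hV).op (GeneratingSections.homRatio f₂ j.castSucc (Fin.last (b + 1))) ∈ nonZeroDivisors Γ(X₂.left, V))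

include hc₁ in
/-- Under the chart hypothesis, `K₁` is an effective Cartier divisor. [folklore] -/
theorem isEffectiveCartier_of_charts₁ : IsEffectiveCartier K₁ := fun x ↦ by
  obtain ⟨U, i, hU, hxU, hKU, hu⟩ := hc₁ x
  exact ⟨U, hxU, _, hu, hKU⟩

include hc₂ in
/-- Under the chart hypothesis, `K₂` is an effective Cartier divisor. [folklore] -/
theorem isEffectiveCartier_of_charts₂ : IsEffectiveCartier K₂ := fun y ↦ by
  obtain ⟨V, j, hV, hyV, hKV, hv⟩ := hc₂ y
  exact ⟨V, hyV, _, hv, hKV⟩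

variable {Z : Scheme} [IsIntegral Z] (β : Z ⟶ pullback X₁.hom X₂.hom)

set_option quotPrecheck false in
/-- Local notation: `G₁ = β ≫ pr₁ ≫ f₁ : Z → ℙ^{a+1}`. -/
local notation "G₁" => ((β ≫ pullback.fst X₁.hom X₂.hom) ≫ f₁)

set_option quotPrecheck false in
/-- Local notation: `G₂ = β ≫ pr₂ ≫ f₂ : Z → ℙ^{b+1}`. -/
local notation "G₂" => ((β ≫ pullback.snd X₁.hom X₂.hom) ≫ f₂)

/-- **The rational function of `β^* pr₁^* (u/xᵢ)|_W` on `β⁻¹W` is `[u/xᵢ]` read on `Z`** through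
`G₁ = β ≫ pr₁ ≫ f₁` (`GeneratingSections.homRatio_comp_eq_appLE`). [folklore] -/
theorem ofSection_appLE_fst_ratio {U : X₁.left.affineOpens} {i : Fin (a + 1)}
    (hU : (U : X₁.left.Opens) ≤ GeneratingSections.preU f₁ i.castSucc)
    {W : (pullback X₁.hom X₂.hom).affineOpens}
    (hWU : (W : (pullback X₁.hom X₂.hom).Opens) ≤ pullback.fst X₁.hom X₂.hom ⁻¹ᵁ U)
    (hη : genericPoint Z ∈ β ⁻¹ᵁ (W : (pullback X₁.hom X₂.hom).Opens))
    (hi : genericPoint Z ∈ GeneratingSections.preU G₁ i.castSucc) :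
    ofSection hη (β.appLE W _ le_rfl ((pullback.fst X₁.hom X₂.hom).appLE U W hWU
      (X₁.left.presheaf.map (homOfLE hU).op
        (GeneratingSections.homRatio f₁ i.castSucc (Fin.last (a + 1)))))) =
      RuledJoin.coordFn G₁ hi (Fin.last (a + 1)) := by
  set s := GeneratingSections.homRatio f₁ i.castSucc (Fin.last (a + 1)) with hs
  have hUW : (W : (pullback X₁.hom X₂.hom).Opens) ≤
      pullback.fst X₁.hom X₂.hom ⁻¹ᵁ GeneratingSections.preU f₁ i.castSucc := fun x hx ↦ hU (hWU hx)
  have hle : β ⁻¹ᵁ (W : (pullback X₁.hom X₂.hom).Opens) ≤ GeneratingSections.preU G₁ i.castSucc :=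
    fun z hz ↦ by
      simp only [GeneratingSections.preU, Scheme.Hom.comp_preimage]
      exact hU (hWU hz)
  -- `pr₁^*(s|_U)|_W = pr₁^* s|_W`
  have ha : (pullback.fst X₁.hom X₂.hom).appLE U W hWU (X₁.left.presheaf.map (homOfLE hU).op s) =
      (pullback.fst X₁.hom X₂.hom).appLE (GeneratingSections.preU f₁ i.castSucc) W hUW s := by
    rw [← CommRingCat.comp_apply, Scheme.Hom.map_appLE]
  -- `β^* pr₁^* = (β ≫ pr₁)^*`
  have hb : β.appLE W _ le_rfl
      ((pullback.fst X₁.hom X₂.hom).appLE (GeneratingSections.preU f₁ i.castSucc) W hUW s) =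
      (β ≫ pullback.fst X₁.hom X₂.hom).appLE (GeneratingSections.preU f₁ i.castSucc)
        (β ⁻¹ᵁ (W : (pullback X₁.hom X₂.hom).Opens)) hle s := by
    rw [← CommRingCat.comp_apply, Scheme.Hom.appLE_comp_appLE]
  -- the right-hand side restricted to `β⁻¹W`
  have hc : Z.presheaf.map (homOfLE hle).op (GeneratingSections.homRatio G₁ i.castSucc (Fin.last (a + 1))) =
      (β ≫ pullback.fst X₁.hom X₂.hom).appLE (GeneratingSections.preU f₁ i.castSucc)
        (β ⁻¹ᵁ (W : (pullback X₁.hom X₂.hom).Opens)) hle s := by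
    rw [GeneratingSections.homRatio_comp_eq_appLE, ← CommRingCat.comp_apply, Scheme.Hom.appLE_map]
  rw [ha, hb, RuledJoin.coordFn, ← ofSection_map (homOfLE hle) hη, hc]

/-- The same for `β^* pr₂^* (v/y_j)|_W`. [folklore] -/
theorem ofSection_appLE_snd_ratio {V : X₂.left.affineOpens} {j : Fin (b + 1)}
    (hV : (V : X₂.left.Opens) ≤ GeneratingSections.preU f₂ j.castSucc)
    {W : (pullback X₁.hom X₂.hom).affineOpens}
    (hWV : (W : (pullback X₁.hom X₂.hom).Opens) ≤ pullback.snd X₁.hom X₂.hom ⁻¹ᵁ V)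
    (hη : genericPoint Z ∈ β ⁻¹ᵁ (W : (pullback X₁.hom X₂.hom).Opens))
    (hj : genericPoint Z ∈ GeneratingSections.preU G₂ j.castSucc) :
    ofSection hη (β.appLE W _ le_rfl ((pullback.snd X₁.hom X₂.hom).appLE V W hWV
      (X₂.left.presheaf.map (homOfLE hV).op
        (GeneratingSections.homRatio f₂ j.castSucc (Fin.last (b + 1)))))) =
      RuledJoin.coordFn G₂ hj (Fin.last (b + 1)) := by
  set s := GeneratingSections.homRatio f₂ j.castSucc (Fin.last (b + 1)) with hs
  have hVW : (W : (pullback X₁.hom X₂.hom).Opens) ≤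
      pullback.snd X₁.hom X₂.hom ⁻¹ᵁ GeneratingSections.preU f₂ j.castSucc := fun x hx ↦ hV (hWV hx)
  have hle : β ⁻¹ᵁ (W : (pullback X₁.hom X₂.hom).Opens) ≤ GeneratingSections.preU G₂ j.castSucc :=
    fun z hz ↦ by
      simp only [GeneratingSections.preU, Scheme.Hom.comp_preimage]
      exact hV (hWV hz)
  have ha : (pullback.snd X₁.hom X₂.hom).appLE V W hWV (X₂.left.presheaf.map (homOfLE hV).op s) =
      (pullback.snd X₁.hom X₂.hom).appLE (GeneratingSections.preU f₂ j.castSucc) W hVW s := by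
    rw [← CommRingCat.comp_apply, Scheme.Hom.map_appLE]
  have hb : β.appLE W _ le_rfl
      ((pullback.snd X₁.hom X₂.hom).appLE (GeneratingSections.preU f₂ j.castSucc) W hVW s) =
      (β ≫ pullback.snd X₁.hom X₂.hom).appLE (GeneratingSections.preU f₂ j.castSucc)
        (β ⁻¹ᵁ (W : (pullback X₁.hom X₂.hom).Opens)) hle s := by
    rw [← CommRingCat.comp_apply, Scheme.Hom.appLE_comp_appLE]
  have hc : Z.presheaf.map (homOfLE hle).op (GeneratingSections.homRatio G₂ j.castSucc (Fin.last (b + 1))) =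
      (β ≫ pullback.snd X₁.hom X₂.hom).appLE (GeneratingSections.preU f₂ j.castSucc)
        (β ⁻¹ᵁ (W : (pullback X₁.hom X₂.hom).Opens)) hle s := by
    rw [GeneratingSections.homRatio_comp_eq_appLE, ← CommRingCat.comp_apply, Scheme.Hom.appLE_map]
  rw [ha, hb, RuledJoin.coordFn, ← ofSection_map (homOfLE hle) hη, hc]

variable {i₀ : Fin (a + 2)} {j₀ : Fin (b + 2)}
  (h₁ : genericPoint Z ∈ GeneratingSections.preU ((β ≫ pullback.fst X₁.hom X₂.hom) ≫ f₁) i₀)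
  (h₂ : genericPoint Z ∈ GeneratingSections.preU ((β ≫ pullback.snd X₁.hom X₂.hom) ≫ f₂) j₀)

include hc₁ hc₂ in
/-- **Chart data on the blow-up of `X₁ ⊗ X₂` along `pr₁⁻¹K₁ + pr₂⁻¹K₂`**: every point `z` lies
in an open `O` over some `D₊(xᵢ) × D₊(y_j)` carrying a section whose rational function is
`[u/xᵢ]/[v/y_j]` or `[v/y_j]/[u/xᵢ]` — namely a principal affine piece of `Z[W, v']` resp.
`Z[W, u']` for a product chart `W` with `𝓘(W) = (u', v')`, `u' = pr₁^*(u/xᵢ)`, `v' = pr₂^*(v/y_j)`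
(`exists_chart_tensorCentre`, `IsBlowup.blowupChart_sup_blowupChart_pair`), the section being
the exceptional coordinate `u'/v'` resp. `v'/u'`. [cite: ShiodaKatsura1979, §1 (1.6) and Thm. 1.7 (i)] -/
theorem exists_chart_section_blowup (hb : IsBlowup β 𝓘) (z : Z) :
    ∃ (i : Fin (a + 1)) (j : Fin (b + 1)) (O : Z.Opens)
      (_ : O ≤ GeneratingSections.preU G₁ i.castSucc) (_ : O ≤ GeneratingSections.preU G₂ j.castSucc)
      (hz : z ∈ O),
      (∃ T : Γ(Z, O), ofSection (genericPoint_mem_of_mem hz) T =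
        (RuledJoin.coordFn G₁ h₁ (Fin.last (a + 1)) / RuledJoin.coordFn G₁ h₁ i.castSucc) /
          (RuledJoin.coordFn G₂ h₂ (Fin.last (b + 1)) / RuledJoin.coordFn G₂ h₂ j.castSucc)) ∨
      (∃ T' : Γ(Z, O), ofSection (genericPoint_mem_of_mem hz) T' =
        (RuledJoin.coordFn G₂ h₂ (Fin.last (b + 1)) / RuledJoin.coordFn G₂ h₂ j.castSucc) /
          (RuledJoin.coordFn G₁ h₁ (Fin.last (a + 1)) / RuledJoin.coordFn G₁ h₁ i.castSucc)) := by
  obtain ⟨U, i, hU, hxU, hKU, hu⟩ := hc₁ (pullback.fst X₁.hom X₂.hom (β z))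
  obtain ⟨V, j, hV, hyV, hKV, hv⟩ := hc₂ (pullback.snd X₁.hom X₂.hom (β z))
  obtain ⟨W, hW, hWU, hWV, hset, hideal, -, -, -, -⟩ :=
    exists_chart_tensorCentre X₁ X₂ K₁ K₂ U.2 V.2 _ _ hKU hKV hu hv
  have hzW : β z ∈ W := by
    rw [← SetLike.mem_coe, hset]
    exact ⟨hxU, hyV⟩
  have hz₁ : z ∈ GeneratingSections.preU G₁ i.castSucc := by
    simp only [GeneratingSections.preU, Scheme.Hom.comp_preimage]
    exact hU (hWU hzW)
  have hz₂ : z ∈ GeneratingSections.preU G₂ j.castSucc := by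
    simp only [GeneratingSections.preU, Scheme.Hom.comp_preimage]
    exact hV (hWV hzW)
  have hη : genericPoint Z ∈ β ⁻¹ᵁ W := genericPoint_mem_of_mem hzW
  have hle₁ : β ⁻¹ᵁ W ≤ GeneratingSections.preU G₁ i.castSucc := fun z' hz' ↦ by
    simp only [GeneratingSections.preU, Scheme.Hom.comp_preimage]
    exact hU (hWU hz')
  have hle₂ : β ⁻¹ᵁ W ≤ GeneratingSections.preU G₂ j.castSucc := fun z' hz' ↦ by
    simp only [GeneratingSections.preU, Scheme.Hom.comp_preimage]
    exact hV (hWV hz')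
  -- the two quotients read through the chart sections `u' = pr₁^*(u/xᵢ)`, `v' = pr₂^*(v/y_j)`
  have hquot₁ : RuledJoin.coordFn G₁ h₁ (Fin.last (a + 1)) / RuledJoin.coordFn G₁ h₁ i.castSucc =
      ofSection hη (β.appLE W _ le_rfl ((pullback.fst X₁.hom X₂.hom).appLE U W hWU
        (X₁.left.presheaf.map (homOfLE hU).op
          (GeneratingSections.homRatio f₁ i.castSucc (Fin.last (a + 1)))))) := by
    rw [RuledJoin.coordFn_div _ _ (genericPoint_mem_of_mem hz₁),
      ofSection_appLE_fst_ratio X₁ X₂ f₁ β hU (W := ⟨W, hW⟩) hWU hη]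
  have hquot₂ : RuledJoin.coordFn G₂ h₂ (Fin.last (b + 1)) / RuledJoin.coordFn G₂ h₂ j.castSucc =
      ofSection hη (β.appLE W _ le_rfl ((pullback.snd X₁.hom X₂.hom).appLE V W hWV
        (X₂.left.presheaf.map (homOfLE hV).op
          (GeneratingSections.homRatio f₂ j.castSucc (Fin.last (b + 1)))))) := by
    rw [RuledJoin.coordFn_div _ _ (genericPoint_mem_of_mem hz₂),
      ofSection_appLE_snd_ratio X₁ X₂ f₂ β hV (W := ⟨W, hW⟩) hWV hη]
  have hmem : z ∈ β ⁻¹ᵁ W := hzW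
  rw [← hb.blowupChart_sup_blowupChart_pair ⟨W, hW⟩ hideal] at hmem
  have huI : (pullback.fst X₁.hom X₂.hom).appLE U W hWU (X₁.left.presheaf.map (homOfLE hU).op
      (GeneratingSections.homRatio f₁ i.castSucc (Fin.last (a + 1)))) ∈
      Scheme.IdealSheafData.ideal 𝓘 ⟨W, hW⟩ :=
    hideal ▸ Ideal.subset_span (by simp)
  have hvI : (pullback.snd X₁.hom X₂.hom).appLE V W hWV (X₂.left.presheaf.map (homOfLE hV).op
      (GeneratingSections.homRatio f₂ j.castSucc (Fin.last (b + 1)))) ∈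
      Scheme.IdealSheafData.ideal 𝓘 ⟨W, hW⟩ :=
    hideal ▸ Ideal.subset_span (by simp)
  rcases hmem with hzu | hzv
  · -- `z ∈ Z[W, u']`: `[v']/[u']` is a section near `z`
    obtain ⟨W', hzW', hW'le, c, hc⟩ := exists_ofSection_eq_div_of_mem_blowupChart β 𝓘 ⟨W, hW⟩ hvI hzu
    refine ⟨i, j, W', hW'le.trans hle₁, hW'le.trans hle₂, hzW', Or.inr ⟨c, ?_⟩⟩
    rw [hquot₁, hquot₂]
    exact hc
  · -- `z ∈ Z[W, v']`: `[u']/[v']` is a section near `z`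
    obtain ⟨W', hzW', hW'le, c, hc⟩ := exists_ofSection_eq_div_of_mem_blowupChart β 𝓘 ⟨W, hW⟩ huI hzv
    refine ⟨i, j, W', hW'le.trans hle₁, hW'le.trans hle₂, hzW', Or.inl ⟨c, ?_⟩⟩
    rw [hquot₁, hquot₂]
    exact hc

include hc₁ hc₂ in
/-- **On the blow-up of `X₁ ⊗ X₂` along `pr₁⁻¹K₁ + pr₂⁻¹K₂`, `u/xᵢ` and `v/y_j` are locally
comparable** (the hypothesis `hZ` of `Resolution/JoinRationalMap`: `[u/xᵢ]/[v/y_j]` or its inverse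
is regular at every point). [cite: ShiodaKatsura1979, §1 (1.6) and Thm. 1.7 (i)] -/
theorem locallyComparable_blowup (hb : IsBlowup β 𝓘) (z : Z) :
    ∃ (i : Fin (a + 1)) (j : Fin (b + 1)),
      z ∈ GeneratingSections.preU G₁ i.castSucc ∧ z ∈ GeneratingSections.preU G₂ j.castSucc ∧
      (IsRegularAt z ((RuledJoin.coordFn G₁ h₁ (Fin.last (a + 1)) / RuledJoin.coordFn G₁ h₁ i.castSucc) /
          (RuledJoin.coordFn G₂ h₂ (Fin.last (b + 1)) / RuledJoin.coordFn G₂ h₂ j.castSucc)) ∨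
        IsRegularAt z ((RuledJoin.coordFn G₂ h₂ (Fin.last (b + 1)) / RuledJoin.coordFn G₂ h₂ j.castSucc) /
          (RuledJoin.coordFn G₁ h₁ (Fin.last (a + 1)) / RuledJoin.coordFn G₁ h₁ i.castSucc))) := by
  obtain ⟨i, j, O, hO₁, hO₂, hz, h⟩ := exists_chart_section_blowup X₁ X₂ f₁ f₂ K₁ K₂ hc₁ hc₂ β h₁ h₂ hb z
  refine ⟨i, j, hO₁ hz, hO₂ hz, ?_⟩
  rcases h with ⟨T, hT⟩ | ⟨T', hT'⟩
  · refine Or.inl ?_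
    rw [← hT, ofSection_eq_toFunctionField hz]
    exact isRegularAt_germ hz T
  · refine Or.inr ?_
    rw [← hT', ofSection_eq_toFunctionField hz]
    exact isRegularAt_germ hz T'

/-! ## `ψ` on field-valued points of the blow-up -/

/-- If an `L`-point `κ` of `X` maps under `r` to `pointOfVec k z` and its point lies over `D₊(xᵢ)`,
then `zᵢ ≠ 0`. [folklore] -/
theorem apply_ne_zero_of_comp_eq_pointOfVec {X : Scheme} {n : ℕ} (r : X ⟶ Proj (grading (Fin (n + 1)) k))
    {L : Type} [Field L] [Algebra k L] (κ : Spec (.of L) ⟶ X) (z : Fin (n + 1) → L) (hz : z ≠ 0)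
    (hr : κ ≫ r = (ProjectiveSpace.pointOfVec k z hz).left) {i : Fin (n + 1)}
    (hκ : κ (IsLocalRing.closedPoint L) ∈ GeneratingSections.preU r i) : z i ≠ 0 := by
  have hpt : (ProjectiveSpace.pointOfVec k z hz).pt = r (κ (IsLocalRing.closedPoint L)) := by
    have := congrArg (fun φ => φ (IsLocalRing.closedPoint L)) hr
    simp only [Scheme.Hom.comp_apply] at this
    exact this.symm
  rw [← ProjectiveSpace.pt_pointOfVec_mem_basicOpen_X_iff (k := k) z hz i, hpt]
  exact hκ

variable (hu : genericPoint Z ∈ GeneratingSections.preU ((β ≫ pullback.fst X₁.hom X₂.hom) ≫ f₁) (Fin.last (a + 1)))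
  (hv : genericPoint Z ∈ GeneratingSections.preU ((β ≫ pullback.snd X₁.hom X₂.hom) ≫ f₂) (Fin.last (b + 1)))
  {N : ℕ} (hN : N + 1 = (a + 1) + (b + 1))

/-- **Shioda–Katsura's morphism on field-valued points: `ψ(κ) = (s x : t y)`.** For an `L`-point
`κ` of the blow-up `Z` over `k` whose images in `ℙ^{a+1}`, `ℙ^{b+1}` have homogeneous coordinates
`x`, `y`, the image `ψ(κ)` is the point `(s x₀ : … : s x_a : t y₀ : … : t y_b)` for some
`(s, t) ≠ (0, 0)` (`s`, `t` read off the exceptional coordinate of the chart containing the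
point of `κ`: `Resolution/JoinRationalMapPoints`). On the exceptional host (`u = v = 0`) this is
the ruled join of `{y = 0}` and `{x = 0}`. [cite: ShiodaKatsura1979, §1 (1.8) and Thm. 1.7 (i)]
[cite: Shioda1979HodgeFermat, Thm. I (proof)] -/
theorem exists_comp_joinMap_eq_pointOfVec (hb : IsBlowup β 𝓘) (f : Z ⟶ Spec (.of k))
    {L : Type} [Field L] [Algebra k L] (κ : Spec (.of L) ⟶ Z)
    (hκf : κ ≫ f = Spec.map (CommRingCat.ofHom (algebraMap k L)))
    (x : Fin (a + 2) → L) (hx : x ≠ 0) (hκ₁ : κ ≫ G₁ = (ProjectiveSpace.pointOfVec k x hx).left)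
    (y : Fin (b + 2) → L) (hy : y ≠ 0) (hκ₂ : κ ≫ G₂ = (ProjectiveSpace.pointOfVec k y hy).left) :
    ∃ (s t : L) (hst : (Fin.append (s • (x ∘ Fin.castSucc)) (t • (y ∘ Fin.castSucc)) ∘ Fin.cast hN :
        Fin (N + 1) → L) ≠ 0),
      κ ≫ RuledJoin.joinMap G₁ G₂ h₁ h₂ hN hu hv
          (locallyComparable_blowup X₁ X₂ f₁ f₂ K₁ K₂ hc₁ hc₂ β h₁ h₂ hb) f =
        (ProjectiveSpace.pointOfVec k _ hst).left := by
  obtain ⟨i, j, O, hO₁, hO₂, hz, h⟩ :=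
    exists_chart_section_blowup X₁ X₂ f₁ f₂ K₁ K₂ hc₁ hc₂ β h₁ h₂ hb (κ (IsLocalRing.closedPoint L))
  have hκO : ⊤ ≤ κ ⁻¹ᵁ O := fun p _ ↦ by
    rw [Subsingleton.elim p (IsLocalRing.closedPoint L)]
    exact hz
  have hxi := apply_ne_zero_of_comp_eq_pointOfVec G₁ κ x hx hκ₁ (hO₁ hz)
  have hyj := apply_ne_zero_of_comp_eq_pointOfVec G₂ κ y hy hκ₂ (hO₂ hz)
  rcases h with ⟨T, hT⟩ | ⟨T', hT'⟩
  · exact ⟨_, _, _, RuledJoin.comp_joinMap_eq_pointOfVec_of_inl G₁ G₂ h₁ h₂ hN hu hv _ f κ hκf hO₁ hO₂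
      (genericPoint_mem_of_mem hz) T hT hκO x hx hκ₁ y hy hκ₂ hxi⟩
  · exact ⟨_, _, _, RuledJoin.comp_joinMap_eq_pointOfVec_of_inr G₁ G₂ h₁ h₂ hN hu hv _ f κ hκf hO₁ hO₂
      (genericPoint_mem_of_mem hz) T' hT' hκO x hx hκ₁ y hy hκ₂ hyj⟩

end Psi

end Literature.AlgebraicGeometry.Motives

end
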